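import Summits.ValiantsHypothesis.ValiantsHypothesis.Theorems.DepthWindowHomBands
import Mathlib.RingTheory.MvPolynomial.Homogeneous
import HarnessLib

/-!
# Band blocks: value congruence (stacking bookkeeping for `HomRelStacks`, part 3)

Route `DepthWindow`, crux item `HomSubReach`, second layer `HomRelStacks`.  For the band-`b`
block `bandBlock kk b n d ds vals G` of `Theorems/DepthWindowHomBands.lean` we define the GRADED
SUBSTITUTION `bandΘ` (an original variable `↦` itself, the placeholder `y_{i,e}` `↦` the
degree-`(e+1)` homogeneous component of the value of gate `i` if gate `i` lies in a lower band,
else `0`) with weights `bandW` (`1` resp. `e + 1`), prove it is graded (`bandΘ_isHomogeneous`),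
and prove the VALUE CONGRUENCE `bandBlock_values`: for every gate `i` of band `b`, the image
under `aeval bandΘ` of the value of its copy in the block agrees with the value of gate `i` in
all homogeneous components of degree `≤ d`.

[cite: LimayeSrinivasanTavenas2025, Lemma 19, Lemma 20] [cite: Burgisser2000, Def. 2.1] [cite: LST2021, §2]
-/

set_option linter.dupNamespace false

namespace Summit.ValiantsHypothesis.ValiantsHypothesis.Theorems.DepthWindow

open MvPolynomial Literature.Computability.AlgebraicComplexity ArithCircuit
open Literature.Computability.AlgebraicComplexity.DepthReduction

variable {k : Type*} [CommSemiring k] {σ : Type*}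

/-! ### The graded substitution of a band -/

section Theta

variable (kk b n d : ℕ) (ds : List ℕ) (vals : List (MvPolynomial σ k))

/-- Weights of the block variables: `1` on original variables, `e + 1` on the placeholder
`y_{i,e}`. [cite: LimayeSrinivasanTavenas2025, Lemma 20] -/
def bandW : σ ⊕ (Fin n × Fin d) → ℕ := Sum.elim (fun _ => 1) (fun p => (p.2 : ℕ) + 1)

/-- The graded substitution of band `b`: `y_{i,e} ↦` degree-`(e+1)` component of `vals[i]` if
gate `i` lies below band `b`, else `0`. [cite: LimayeSrinivasanTavenas2025, Lemma 20] -/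
noncomputable def bandΘ : σ ⊕ (Fin n × Fin d) → MvPolynomial σ k :=
  Sum.elim X (fun p => if bandOf kk ds p.1 < b then
    weightedHomogeneousComponent (1 : σ → ℕ) ((p.2 : ℕ) + 1) (vals.getD p.1 0) else 0)

omit [CommSemiring k] in
/-- All block weights are positive. -/
theorem bandW_pos : ∀ t : σ ⊕ (Fin n × Fin d), 1 ≤ bandW n d t
  | Sum.inl _ => le_rfl
  | Sum.inr _ => by simp [bandW]

/-- The band substitution is graded for the block weights. [cite: LimayeSrinivasanTavenas2025, Lemma 20] -/
theorem bandΘ_isHomogeneous : ∀ t : σ ⊕ (Fin n × Fin d),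
    (bandΘ kk b n d ds vals t).IsHomogeneous (bandW n d t)
  | Sum.inl x => by simpa [bandΘ, bandW] using isHomogeneous_X k x
  | Sum.inr p => by
      simp only [bandΘ, bandW, Sum.elim_inr]
      split_ifs
      · exact weightedHomogeneousComponent_isWeightedHomogeneous _ _
      · exact isHomogeneous_zero _ _ _

/-- `bandΘ` on an original variable. -/
@[simp] theorem bandΘ_inl (x : σ) : bandΘ kk b n d ds vals (Sum.inl x) = X x := rfl

/-- `bandΘ` on a placeholder. -/
theorem bandΘ_inr (p : Fin n × Fin d) : bandΘ kk b n d ds vals (Sum.inr p) =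
    if bandOf kk ds p.1 < b then
      weightedHomogeneousComponent (1 : σ → ℕ) ((p.2 : ℕ) + 1) (vals.getD p.1 0) else 0 := rfl

end Theta

/-! ### Values of the component-sum gates -/

/-- Components of `C (coeff₀ v) + Σ_{e<d} (degree-(e+1) component of v)` up to degree `d` are
those of `v`. [cite: LimayeSrinivasanTavenas2025, Lemma 20] -/
theorem components_coeff_add_sum (v : MvPolynomial σ k) (d : ℕ) {e' : ℕ} (he' : e' ≤ d) :
    weightedHomogeneousComponent (1 : σ → ℕ) e'
        (C (coeff 0 v) + ∑ e : Fin d, weightedHomogeneousComponent (1 : σ → ℕ) ((e : ℕ) + 1) v) =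
      weightedHomogeneousComponent (1 : σ → ℕ) e' v := by
  have hC : IsWeightedHomogeneous (1 : σ → ℕ) (C (coeff 0 v) : MvPolynomial σ k) 0 :=
    isWeightedHomogeneous_C _ _
  rw [map_add, map_sum]
  by_cases h0 : e' = 0
  · subst h0
    have h0c : weightedHomogeneousComponent (1 : σ → ℕ) 0 v = C (coeff 0 v) :=
      weightedHomogeneousComponent_zero v (fun _ => one_ne_zero)
    rw [hC.weightedHomogeneousComponent_same, h0c, Finset.sum_eq_zero fun e _ => ?_, add_zero]
    exact (weightedHomogeneousComponent_isWeightedHomogeneous _ v).weightedHomogeneousComponent_ne 0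
      (by omega)
  · rw [hC.weightedHomogeneousComponent_ne e' h0, zero_add,
      Finset.sum_eq_single ⟨e' - 1, by omega⟩]
    · have : ((⟨e' - 1, by omega⟩ : Fin d) : ℕ) + 1 = e' := by simp; omega
      rw [this]
      exact (weightedHomogeneousComponent_isWeightedHomogeneous _ v).weightedHomogeneousComponent_same
    · intro e _ hne
      refine (weightedHomogeneousComponent_isWeightedHomogeneous _ v).weightedHomogeneousComponent_ne e' ?_
      intro h
      apply hne
      ext
      simp
      omega
    · simp

/-- The value of the component-sum gate `s_i` (independent of the prefix values). -/
theorem eval_sGate (n d : ℕ) (vals : List (MvPolynomial σ k)) (i : Fin n)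
    (V : List (MvPolynomial (σ ⊕ (Fin n × Fin d)) k)) :
    (sGate n d vals i).eval V = C (coeff 0 (vals.getD i 0)) + ∑ e : Fin d, X (Sum.inr (i, e)) := by
  simp only [sGate, Gate.eval, List.map_cons, List.map_map, Function.comp_def, Operand.eval,
    List.sum_cons, smul_eq_C_mul, C_1, mul_one, one_mul]
  rw [Fin.sum_univ_def]

/-- Gates whose value does not depend on the prefix values: `gateValues` is the map. -/
theorem gateValues_eq_map_of_indep {τ : Type*} (A : List (Gate k τ)) (v : Gate k τ → MvPolynomial τ k)
    (h : ∀ g ∈ A, ∀ V, g.eval V = v g) : gateValues A = A.map v := by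
  induction A using List.reverseRecOn with
  | nil => simp [gateValues]
  | append_singleton A g ih =>
      rw [gateValues_append_singleton, ih fun g' hg' => h g' (by simp [hg']), List.map_append,
        List.map_singleton, h g (by simp)]

/-- The values of the component-sum gates. -/
theorem getD_gateValues_sGates (n d : ℕ) (vals : List (MvPolynomial σ k)) {idx : ℕ} (hidx : idx < n) :
    (gateValues (sGates n d vals)).getD idx 0 =
      C (coeff 0 (vals.getD idx 0)) + ∑ e : Fin d, X (Sum.inr ((⟨idx, hidx⟩ : Fin n), e)) := by
  rw [gateValues_eq_map_of_indep (sGates n d vals)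
      (fun g => g.eval ([] : List (MvPolynomial (σ ⊕ (Fin n × Fin d)) k))) ?_]
  · rw [List.getD_eq_getElem _ _ (by simpa [sGates]), List.getElem_map]
    simp only [sGates, List.getElem_map, List.getElem_finRange]
    rw [eval_sGate]
    rfl
  · intro g hg V
    simp only [sGates, List.mem_map] at hg
    obtain ⟨i, -, rfl⟩ := hg
    rw [eval_sGate, eval_sGate]

/-- Image of a component-sum value under the band substitution: components `≤ d` of a lower-band
gate value are reproduced. [cite: LimayeSrinivasanTavenas2025, Lemma 20] -/
theorem components_aeval_sVal (kk b n d : ℕ) (ds : List ℕ) (vals : List (MvPolynomial σ k))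
    {idx : ℕ} (hidx : idx < n) (hband : bandOf kk ds idx < b) {e' : ℕ} (he' : e' ≤ d) :
    weightedHomogeneousComponent (1 : σ → ℕ) e' (aeval (bandΘ kk b n d ds vals)
        (C (coeff 0 (vals.getD idx 0)) + ∑ e : Fin d, X (Sum.inr ((⟨idx, hidx⟩ : Fin n), e)))) =
      weightedHomogeneousComponent (1 : σ → ℕ) e' (vals.getD idx 0) := by
  rw [map_add, map_sum, algHom_C, algebraMap_eq]
  simp only [aeval_X, bandΘ_inr, hband, if_true]
  exact components_coeff_add_sum _ d he'

/-! ### Operand and gate congruence -/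

/-- **Operand congruence**: against block values satisfying the invariant, a lifted operand of a
band-`b` gate `i` maps under `aeval bandΘ` to a polynomial with the same components `≤ d` as the
original operand value. [cite: LimayeSrinivasanTavenas2025, Lemma 20] -/
theorem components_liftOp (kk b d : ℕ) (G : List (Gate k σ)) {i : ℕ} (hi : i < G.length)
    (VΦ : List (MvPolynomial (σ ⊕ (Fin G.length × Fin d)) k))
    (ha : ∀ idx < G.length, bandOf kk (gateWDepths prodWeight G) idx < b → ∀ e ≤ d,
      weightedHomogeneousComponent (1 : σ → ℕ) e
          (aeval (bandΘ kk b G.length d (gateWDepths prodWeight G) (gateValues G)) (VΦ.getD idx 0)) =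
        weightedHomogeneousComponent (1 : σ → ℕ) e ((gateValues G).getD idx 0))
    (hb : ∀ i' < i, bandOf kk (gateWDepths prodWeight G) i' = b → ∀ e ≤ d,
      weightedHomogeneousComponent (1 : σ → ℕ) e
          (aeval (bandΘ kk b G.length d (gateWDepths prodWeight G) (gateValues G))
            (VΦ.getD (G.length + i') 0)) =
        weightedHomogeneousComponent (1 : σ → ℕ) e ((gateValues G).getD i' 0))
    (hband : bandOf kk (gateWDepths prodWeight G) i = b) :
    ∀ u ∈ G[i].args, ∀ e ≤ d,
      weightedHomogeneousComponent (1 : σ → ℕ) e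
          (aeval (bandΘ kk b G.length d (gateWDepths prodWeight G) (gateValues G))
            ((liftOp kk b G.length d (gateWDepths prodWeight G) i u).eval VΦ)) =
        weightedHomogeneousComponent (1 : σ → ℕ) e (u.eval ((gateValues G).take i)) := by
  intro u hu e he
  cases u with
  | var x => simp [liftOp, Operand.eval]
  | const c => simp [liftOp, Operand.eval, algebraMap_eq]
  | gate i' =>
      simp only [liftOp]
      by_cases hi' : i' < i
      · rw [if_pos hi']
        have horig : Operand.eval ((gateValues G).take i) (Operand.gate i' : Operand k σ) =
            (gateValues G).getD i' 0 := by
          simp only [Operand.eval, List.getD_eq_getElem?_getD, List.getElem?_take_of_lt hi']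
        rw [horig]
        by_cases hbb : bandOf kk (gateWDepths prodWeight G) i' < b
        · rw [if_pos hbb, Operand.eval]
          exact ha i' (by omega) hbb e he
        · rw [if_neg hbb, Operand.eval]
          have hle : bandOf kk (gateWDepths prodWeight G) i' ≤ b := by
            rw [← hband]
            refine bandOf_mono kk _ ?_
            have := getD_gateWDepths_le_of_mem_args G hi hi' hu
            omega
          exact hb i' hi' (by omega) e he
      · rw [if_neg hi']
        have horig : Operand.eval ((gateValues G).take i) (Operand.gate i' : Operand k σ) = 0 := by
          rw [Operand.eval, List.getD_eq_default]
          rw [List.length_take]; omega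
        rw [horig]
        simp [Operand.eval]

/-- **Gate congruence**: sums by linearity, products by the antidiagonal expansion of components
(each factor component has degree `≤ e ≤ d`). [cite: LimayeSrinivasanTavenas2025, Lemma 20] -/
theorem components_liftGate (kk b n d : ℕ) (ds : List ℕ)
    (Θ : σ ⊕ (Fin n × Fin d) → MvPolynomial σ k) {i : ℕ} (hband : bandOf kk ds i = b)
    (VΦ : List (MvPolynomial (σ ⊕ (Fin n × Fin d)) k)) (V : List (MvPolynomial σ k)) (g : Gate k σ)
    (hOC : ∀ u ∈ g.args, ∀ e ≤ d,
      weightedHomogeneousComponent (1 : σ → ℕ) e (aeval Θ ((liftOp kk b n d ds i u).eval VΦ)) =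
        weightedHomogeneousComponent (1 : σ → ℕ) e (u.eval V)) :
    ∀ e ≤ d, weightedHomogeneousComponent (1 : σ → ℕ) e
        (aeval Θ ((liftGate kk b n d ds i g).eval VΦ)) =
      weightedHomogeneousComponent (1 : σ → ℕ) e (g.eval V) := by
  intro e he
  cases g with
  | sum args =>
      simp only [liftGate, hband, if_true, Gate.eval, List.map_map, Function.comp_def, smul_eq_C_mul,
        map_list_sum, map_mul, algHom_C, algebraMap_eq, weightedHomogeneousComponent_C_mul]
      congr 1
      refine List.map_congr_left fun a ha => ?_
      rw [hOC a.2 (List.mem_map.mpr ⟨a, ha, rfl⟩) e he]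
  | prod us =>
      simp only [liftGate, hband, if_true, Gate.eval, List.map_map, Function.comp_def, map_list_prod]
      rw [prod_map_eq_prod_get us, prod_map_eq_prod_get us,
        weightedHomogeneousComponent_prod_univ, weightedHomogeneousComponent_prod_univ]
      congr 1
      refine List.map_congr_left fun f hf => Finset.prod_congr rfl fun l _ => ?_
      exact hOC (us.get l) (List.get_mem us l) (f l) ((le_of_mem_antidiagonalTuple hf l).trans he)

/-! ### The value congruence of the band block -/

/-- **Value invariant of the band block** along prefixes of `G`.
[cite: LimayeSrinivasanTavenas2025, Lemma 20] -/
theorem bandBlock_values_inv (kk b d : ℕ) (G : List (Gate k σ)) :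
    ∀ i : ℕ, i ≤ G.length →
      (∀ idx < G.length, bandOf kk (gateWDepths prodWeight G) idx < b → ∀ e ≤ d,
        weightedHomogeneousComponent (1 : σ → ℕ) e
            (aeval (bandΘ kk b G.length d (gateWDepths prodWeight G) (gateValues G))
              ((gateValues (bandBlock kk b G.length d (gateWDepths prodWeight G) (gateValues G)
                (G.take i))).getD idx 0)) =
          weightedHomogeneousComponent (1 : σ → ℕ) e ((gateValues G).getD idx 0)) ∧
      (∀ i' < i, bandOf kk (gateWDepths prodWeight G) i' = b → ∀ e ≤ d,
        weightedHomogeneousComponent (1 : σ → ℕ) e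
            (aeval (bandΘ kk b G.length d (gateWDepths prodWeight G) (gateValues G))
              ((gateValues (bandBlock kk b G.length d (gateWDepths prodWeight G) (gateValues G)
                (G.take i))).getD (G.length + i') 0)) =
          weightedHomogeneousComponent (1 : σ → ℕ) e ((gateValues G).getD i' 0)) := by
  intro i
  induction i with
  | zero =>
      intro _
      rw [List.take_zero, bandBlock_nil]
      refine ⟨fun idx hidx hband e he => ?_, fun i' hi' => absurd hi' (Nat.not_lt_zero _)⟩
      rw [getD_gateValues_sGates _ _ _ hidx]
      exact components_aeval_sVal kk b G.length d _ _ hidx hband he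
  | succ i ih =>
      intro hi
      have hi' : i < G.length := hi
      obtain ⟨hs, hl⟩ := ih hi'.le
      set Φ := bandBlock kk b G.length d (gateWDepths prodWeight G) (gateValues G) (G.take i) with hΦ
      have hlenΦ : (gateValues Φ).length = G.length + i := by
        rw [gateValues_length, hΦ, length_bandBlock, List.length_take, min_eq_left hi'.le]
      have hstep : bandBlock kk b G.length d (gateWDepths prodWeight G) (gateValues G) (G.take (i + 1)) =
          Φ ++ [liftGate kk b G.length d (gateWDepths prodWeight G) i G[i]] := by
        rw [List.take_succ_eq_append_getElem hi', bandBlock_append_singleton, List.length_take,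
          min_eq_left hi'.le]
      rw [hstep, gateValues_append_singleton]
      refine ⟨fun idx hidx hband e he => ?_, fun i' hi'' hband e he => ?_⟩
      · rw [List.getD_append _ _ _ _ (by omega)]; exact hs idx hidx hband e he
      · rcases Nat.lt_succ_iff_lt_or_eq.mp hi'' with hlt | rfl
        · rw [List.getD_append _ _ _ _ (by omega)]; exact hl i' hlt hband e he
        · rw [getD_append_at_length _ _ _ hlenΦ.symm, getD_gateValues G hi', gateValues_take_eq_take]
          exact components_liftGate kk b G.length d (gateWDepths prodWeight G)
            (bandΘ kk b G.length d (gateWDepths prodWeight G) (gateValues G)) hband (gateValues Φ)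
            ((gateValues G).take i') G[i'] (components_liftOp kk b d G hi' (gateValues Φ) hs hl hband) e he

/-- **Value congruence of the band block**: for every gate `i` of band `b`, the value of its
copy (index `n + i`) maps under the band substitution to a polynomial with the same homogeneous
components of degree `≤ d` as the value of gate `i`. [cite: LimayeSrinivasanTavenas2025, Lemma 20] -/
theorem bandBlock_values (kk b d : ℕ) (G : List (Gate k σ)) {i : ℕ} (hi : i < G.length)
    (hband : bandOf kk (gateWDepths prodWeight G) i = b) {e : ℕ} (he : e ≤ d) :
    weightedHomogeneousComponent (1 : σ → ℕ) e
        (aeval (bandΘ kk b G.length d (gateWDepths prodWeight G) (gateValues G))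
          ((gateValues (bandBlock kk b G.length d (gateWDepths prodWeight G) (gateValues G) G)).getD
            (G.length + i) 0)) =
      weightedHomogeneousComponent (1 : σ → ℕ) e ((gateValues G).getD i 0) := by
  have h := (bandBlock_values_inv kk b d G G.length le_rfl).2
  rw [List.take_length] at h
  exact h i hi hband e he

/-- Lower-band gates read through the component-sum gates: components `≤ d` reproduced.
[cite: LimayeSrinivasanTavenas2025, Lemma 20] -/
theorem bandBlock_values_low (kk b d : ℕ) (G : List (Gate k σ)) {idx : ℕ} (hidx : idx < G.length)
    (hband : bandOf kk (gateWDepths prodWeight G) idx < b) {e : ℕ} (he : e ≤ d) :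
    weightedHomogeneousComponent (1 : σ → ℕ) e
        (aeval (bandΘ kk b G.length d (gateWDepths prodWeight G) (gateValues G))
          ((gateValues (bandBlock kk b G.length d (gateWDepths prodWeight G) (gateValues G) G)).getD
            idx 0)) =
      weightedHomogeneousComponent (1 : σ → ℕ) e ((gateValues G).getD idx 0) := by
  have h := (bandBlock_values_inv kk b d G G.length le_rfl).1
  rw [List.take_length] at h
  exact h idx hidx hband e he

end Summit.ValiantsHypothesis.ValiantsHypothesis.Theorems.DepthWindow
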